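import Literature.Geometry.Lorentzian.TeukolskyRealAxisModeStability
import HarnessLib

/-!
# Quantitative real-axis mode stability for the Teukolsky equation, uniform in `|a| < M` —
# Teixeira da Costa 2020, Theorem 5.1 (subextremal slice) — named fact

Cite item `wi-26994` (route FinalStateConjecture/…, crux `KappaExplicitWaveDecay`,
`stmt-FinalStateConjecture-10654`): an EXPLICIT lower bound on the Wronskian of the horizon- and
infinity-normalised radial Teukolsky solutions on the real frequency axis, UNIFORM in the Kerr
parameter `a ∈ (−M, M)` (it retires the "inexplicit in `a`" clause of Shlapentokh-Rothman's 2015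
bound). Companion of `Literature/Geometry/Lorentzian/TeukolskyRealAxisModeStability.lean`
(qualitative Thm. 4.1; its vocabulary `Kerr.IsRadialTeukolskySolution`, `Kerr.horizonExponent`,
`Kerr.IsOutgoingAtHorizon/AtInfinity` is reused) and of `TeukolskyWronskianBoundProofs.lean`
(proved: constancy of `𝔚` in `r`, Remark 5.1; `𝔚 ≠ 0`, Corollary 5.1; the per-configuration bound).

## Source (read 2026-08-16: arXiv:1910.02854 = CMP 378 (2020) 705–781 [Costa2019], §1 p. 5,
§2.2.1 Def. 2.1, §2.2.3 Def. 2.3, §5.1 Def. 5.1 / Cor. 5.1 / Thm. 5.1 / Cor. 5.2 (p. 34),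
§6.2 Prop. 6.3 / Remark 6.4 (pp. 43–44))

* §1 (p. 5): "`𝔚^{[s]} := Δ^{1+s} [R^{[s]}_{𝓗⁺} (d/dr) R^{[s]}_{𝓘⁺} − R^{[s]}_{𝓘⁺} (d/dr) R^{[s]}_{𝓗⁺}]`
  … is nonvanishing … Note that `𝔚^{[s]}` depends only on the frequency parameters."; Thm. 1.3
  (rough statement): "in any compact set, `𝒜`, of real frequency parameters where Theorems 1.1 and
  1.2 hold, `|𝔚^{[s]}|⁻¹ ≤ C(𝒜, M, s) < ∞`, for any `|a| ≤ M`".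
* **Definition 2.1**: "`m` is admissible with respect to `s` when, if `s` is an integer, `m` is also
  an integer and when, if `s` is a half-integer, so is `m`"; "the frequency triple `(ω, m, λ)` is
  admissible with respect to `s` when `m` is admissible with respect to `s` and
  `(ω, λ) ∈ {Im ω > 0 and Im(λ ω̄) < 0} ∪ (ℝ∖{0}) × ℝ`"; `ω₊ := a/(2Mr₊)`.
* **Definition 2.3** (`|a| < M`): `R_{𝓗⁺}` is the classical solution of the homogeneous radial ODE
  with "`R_{𝓗⁺}(r)(r−r₊)^{−ξ+s}` is smooth at `r = r₊`" and
  "`|((r²+a²)^{1/2} Δ^{s} (r−r₊)^{−ξ} R_{𝓗⁺})|_{r=r₊}|² = 1`"; `R_{𝓘⁺}` the one with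
  "`R_{𝓘⁺} ∼ e^{iωr} r^{2Miω−2s−1}`" (the footnote's expansion) and
  "`|(e^{−iωr} r^{−2iMω} Δ^{s} (r²+a²)^{1/2} R_{𝓘⁺})|_{r=∞}|² = 1`". (These fix the solutions up to a
  unimodular constant; `|𝔚|` is unaffected.) `u_{𝓗⁺,𝓘⁺} := (r²+a²)^{1/2} Δ^{s/2} R_{𝓗⁺,𝓘⁺}`,
  `dr*/dr = (r²+a²)/Δ`.
* **Definition 5.1**: "`𝔚^{[s]}(ω,m,λ) := (u_{𝓘⁺})'·u_{𝓗⁺} − (u_{𝓗⁺})'·u_{𝓘⁺}`" (`' = d/dr*`; Remark 5.1: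
  independent of `r*`) — equal to the §1 expression `Δ^{1+s}[R_{𝓗⁺} R'_{𝓘⁺} − R_{𝓘⁺} R'_{𝓗⁺}]`.
* **Theorem 5.1** (p. 34): "Fix `M > 0` and `s ∈ ½ℤ`. Let `𝒜` be a set of frequency parameters
  `(ω,m,λ)` admissible with respect to `s` such that `ω` is real and
  `C_𝒜 := sup_{(a,ω,m,l)∈[−M,M]×𝒜} (|ω| + |ω|⁻¹ + |ω − am/(2M²)|⁻¹ δ_{|a|,M} + |m| + |λ|) < ∞`,
  where `δ_{|a|,M}` is the Kronecker delta. Then `sup_{(ω,m,λ)∈𝒜} |𝔚^{[s]}|⁻¹ ≤ G(C_𝒜, M, |s|) < ∞`,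
  where `G` will be given in an explicitly computable manner by (5.x)." (The text before it: the
  bound "is uniform in the specific angular momentum of a Kerr black hole", i.e. it holds for every
  `|a| ≤ M` with the same `G`; Thm. 1.3 above says the same.)
* **Proposition 6.3** / **Remark 6.4** (pp. 43–44): with `C_{𝒜′} := sup_{𝒜′}(|ω| + |ω|⁻¹ + |m| + |λ|)`
  (no threshold term) the display reads
  `sup_{[−M,M]×𝒜′} ((|ω−mω₊|)^{1−2s} δ_{|a|,M} + 1) |𝔚^{[s]}|⁻² ≤ G(C_{𝒜′}, M, |s|)`, described by
  Remark 6.4 as "an upper bound for the RATE OF BLOW-UP of `|𝔚|⁻¹` in the double limit `ω → mω₊`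
  and `|a| → M`"; its sketch proves, at `|a| = M`, `|ω − mω₊|^{1±2s} |𝔚^{[±s]}|⁻² ≲ 1` and then
  appeals to "the uniform boundedness of the Wronskian in the subextremal case (Theorem 5.1)".

## What is vendored (and how)

ONE named fact, `Costa2019_wronskianBound_subextremal`: **Theorem 5.1 restricted to the
subextremal parameters `|a| < M`**, pointwise in the frequencies (equivalent to the printed `sup`
form: given the printed `G`, use `C ↦ G(C_{𝒜_C}, M, |s|)²` with `𝒜_C` the set of all admissible
real-frequency triples whose constant is `≤ C`; conversely take `C := C_𝒜`). The frequency constant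
is the printed one with its `sup` over `a ∈ [−M, M]` EVALUATED: the Kronecker-delta term
`|ω − am/(2M²)|⁻¹ δ_{|a|,M}` vanishes for `|a| < M` and equals `|ω ∓ m/(2M)|⁻¹` at `a = ±M`, so
`sup_a (…) = |ω| + |ω|⁻¹ + max(|ω − m/(2M)|⁻¹, |ω + m/(2M)|⁻¹) + |m| + |λ|` — the frequency set must
stay away from `ω = 0` AND from the extremal superradiant thresholds `ω = ±m/(2M)` (where
`|·|⁻¹ = ∞` in the source; since Mathlib's `0⁻¹ = 0`, the exclusions `ω ≠ 0`, `ω ≠ ±m/(2M)` are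
ALSO written as explicit hypotheses). Statement: for `M > 0` and `2s ∈ ℤ` there is `G : ℝ → ℝ`
such that for every bound `C`, every `|a| < M`, every `m` with `m − s ∈ ℤ`, real `ω ∉ {0, ±m/(2M)}`,
real `λ` with the constant above `≤ C`, and every pair of classical radial solutions `R_𝓗, R_𝓘`
normalised as in Def. 2.3 (`IsNormalisedHorizonSolution`, `IsNormalisedInfinitySolution`):
`0 < G(C)` and `1 ≤ G(C) · |𝔚(r)|²` at every `r > r₊` (`𝔚 = radialWronskian`,
`Δ^{1+s}(R_𝓗 R'_𝓘 − R_𝓘 R'_𝓗)` with Mathlib's `deriv`, constant in `r` for solutions — Remark 5.1,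
proved as `Costa2019.radialWronskian_eq` in the companion file). The printed bound `|𝔚|⁻¹ ≤ G` is
written `1 ≤ G·|𝔚|²` (the printed `G` squared; this keeps the inverse-of-zero junk value out of the
statement and is the shape of the per-configuration bound `Costa2019.wronskianBound_fixed` and of
the energy / transmission-coefficient consumers, Cor. 5.3). NOT rendered: the extremal case
`|a| = M` (extremal boundary conditions of Def. 2.3), "explicitly computable" (only existence of `G`
depending on `(C, M, s)`; the printed `G` depends on `s` through `|s|` only, a uniformity not
asserted), Cor. 5.2 (continuity in `ω`), Cor. 5.3 / Cor. 6.1 (transmission coefficients) and the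
extremal blow-up RATE of Prop. 6.3. Proved here: the fact forces `𝔚 ≠ 0`
(`Costa2019_wronskianBound_subextremal.wronskian_ne_zero`).

## Erratum history (statement CORRECTED IN PLACE, verdict clean-up 2026-08-16)

From 2026-08-15 to 2026-08-16 this def transcribed the DISPLAY of Prop. 6.3 restricted to
`|a| < M` (weight `1`): the same conclusion for ALL real `ω ≠ 0` with `|ω| + |ω|⁻¹ + |m| + |λ| ≤ C`
— no exclusion of the extremal thresholds `±m/(2M)`. The tenured prove seat found (cite item
`wi-26994`, evidence `EVIDENCE.md`, `MISSTATED.md`, `tables.md`, `wronskian_s0.py`) that this is not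
a theorem of the source and is false: (i) the only `a`-uniform subextremal statement proved there
is Theorem 5.1, whose `C_𝒜` contains `max(|ω ∓ m/(2M)|⁻¹)` through the `sup` over `a = ±M` (so also
Thm. 1.3: "where Theorems 1.1 and 1.2 hold"; abstract: "excluding zero frequency and the
superradiant threshold"), and Prop. 6.3's subextremal part is justified only by "Combining with …
(Theorem 5.1)" (p. 44); (ii) Remark 6.4 states that `|𝔚|⁻¹` BLOWS UP in the double limit
`ω → mω₊`, `|a| → M`, which a bound uniform over `|a| < M` near `ω = m/(2M)` contradicts; (iii)
numerically (`s = 0`, `M = 1`, `m = 2`, `λ = 5.86`, `C = 10`; Def. 2.3 normalisations; flux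
identity `|𝔚|² = 4ω(mω₊ − ω)/Z` checked to `10⁻¹⁰`), at the subextremal threshold `ω = mω₊(a)`,
`|𝔚|² = 68.7, 15.7, 6.91, 2.88, 1.03, 0.336, 0.109, 0.0344, 0.0108, 3.46·10⁻³, 1.09·10⁻³` for
`M − a = 10⁻¹, …, 10⁻¹¹` (`|𝔚|² ≈ 490 κ₊ → 0`), so `inf |𝔚|² = 0` on a fixed-`C` range and no `G(C)`
exists, while on `{|ω ∓ m/(2M)| ≥ 1/C}` the same data give `|𝔚|² ≳ c(m,λ)|ω − m/(2M)|`, consistent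
with Thm. 5.1. The correction (this file, 2026-08-16) SHARPENS THE HYPOTHESES to those of
Theorem 5.1 — `ω ≠ ±m/(2M)` and `max(|ω − m/(2M)|⁻¹, |ω + m/(2M)|⁻¹)` added to the frequency sum —
and changes nothing else; the name is kept (the conclusion users consume is unchanged; the
replacement name `Costa2019_quantitativeModeStability_subextremal` announced in the
`KappaExplicitWaveDecay` crux texts is THIS def — no alias is minted, D-0026). Texts of 2026-08-16
calling this name "false as registered" refer to the superseded transcription.
-/

noncomputable section

open Complex Set

namespace Literature.Geometry.Lorentzian.Kerr

/-! ### Normalised horizon / infinity solutions (Def. 2.3, `|a| < M`) and the Wronskian -/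

/-- **`R_{𝓗⁺}` (Teixeira da Costa Def. 2.3, case `|a| < M`), up to a unimodular constant**:
`R(r)(r − r₊)^{s−ξ}` agrees on `(r₊, r₊ + ε)` with a function `f` smooth on a neighbourhood of
`r₊` (the outgoing condition of `IsOutgoingAtHorizon`), normalised by
`|((r²+a²)^{1/2} Δ^{s} (r−r₊)^{−ξ} R)|_{r=r₊}|² = 1`, i.e. — since `Δ^s (r−r₊)^{−ξ} R = (r−r₋)^s f` —
`|f(r₊)| · (r₊² + a²)^{1/2} (r₊ − r₋)^s = 1`. [cite: Costa2019, Definition 2.3] -/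
def IsNormalisedHorizonSolution (M a s ω m : ℝ) (R : ℝ → ℂ) : Prop :=
  ∃ ε : ℝ, 0 < ε ∧ ∃ f : ℝ → ℂ,
    ContDiffOn ℝ ((⊤ : ℕ∞) : WithTop ℕ∞) f (Ioo (rPlus M a - ε) (rPlus M a + ε)) ∧
    (∀ r ∈ Ioo (rPlus M a) (rPlus M a + ε),
      R r * ((r - rPlus M a : ℝ) : ℂ) ^ ((s : ℂ) - horizonExponent M a ω m) = f r) ∧
    ‖f (rPlus M a)‖ * (Real.sqrt (rPlus M a ^ 2 + a ^ 2) * (rPlus M a - rMinus M a) ^ s) = 1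

/-- **`R_{𝓘⁺}` (Teixeira da Costa Def. 2.3), up to a unimodular constant**: the outgoing expansion
at infinity of `IsOutgoingAtInfinity` ("`R ∼ e^{iωr} r^{2Miω−2s−1}`": constants `c_k` with
`R(r) = e^{iωr+2iMω log r} ∑_{k ≤ N} c_k r^{−2s−k−1} + O(r^{−2s−N−2})` for every `N ≥ 1`),
normalised by `|(e^{−iωr} r^{−2iMω} Δ^{s} (r²+a²)^{1/2} R)|_{r=∞}|² = 1`, i.e. `|c₀| = 1`.
[cite: Costa2019, Definition 2.3] -/
def IsNormalisedInfinitySolution (M s ω : ℝ) (R : ℝ → ℂ) : Prop :=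
  ∃ c : ℕ → ℂ, ‖c 0‖ = 1 ∧ ∀ N : ℕ, 1 ≤ N → ∃ C r₀ : ℝ, ∀ r : ℝ, r₀ ≤ r →
    ‖R r - exp (I * ω * r + 2 * I * M * ω * Real.log r) *
        ∑ k ∈ Finset.range (N + 1), c k * ((r ^ (-(2 * s) - (k : ℝ) - 1) : ℝ) : ℂ)‖ ≤
      C * r ^ (-(2 * s) - (N : ℝ) - 2)

/-- **The Wronskian `𝔚 = Δ^{1+s} (R_𝓗 R'_𝓘 − R_𝓘 R'_𝓗)`** of two radial functions at `r`
(Teixeira da Costa §1; equal to the `u`-Wronskian `(u_𝓘)′ u_𝓗 − (u_𝓗)′ u_𝓘` of Def. 5.1 in the `r*`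
variable, and constant in `r` for solutions of the radial ODE). `deriv` is Mathlib's derivative
(junk `0` off the differentiability locus; only applied to classical solutions).
[cite: Costa2019, Definition 5.1 and §1] -/
def radialWronskian (M a s : ℝ) (RH RI : ℝ → ℂ) (r : ℝ) : ℂ :=
  ((delta M a r ^ (1 + s) : ℝ) : ℂ) * (RH r * deriv RI r - RI r * deriv RH r)

/-- `radialWronskian` unfolded. [folklore] -/
theorem radialWronskian_apply (M a s : ℝ) (RH RI : ℝ → ℂ) (r : ℝ) :
    radialWronskian M a s RH RI r =
      ((delta M a r ^ (1 + s) : ℝ) : ℂ) * (RH r * deriv RI r - RI r * deriv RH r) := rfl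

/-! ### The named fact: Theorem 5.1 for `|a| < M` -/

/-- **Teixeira da Costa 2020, Theorem 5.1 (quantitative mode stability on the real axis, uniform
in the Kerr parameter), subextremal parameters `|a| < M`** — statement corrected in place
2026-08-16 (module docstring, Erratum history: the 2026-08-15 transcription of the display of
Prop. 6.3 lacked the threshold exclusion and was false). As printed: "Fix `M > 0` and `s ∈ ½ℤ`.
Let `𝒜` be a set of frequency parameters `(ω,m,λ)` admissible with respect to `s` such that `ω` is
real and `C_𝒜 := sup_{(a,ω,m,l)∈[−M,M]×𝒜} (|ω| + |ω|⁻¹ + |ω − am/(2M²)|⁻¹ δ_{|a|,M} + |m| + |λ|) < ∞`,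
where `δ_{|a|,M}` is the Kronecker delta. Then `sup_{(ω,m,λ)∈𝒜} |𝔚^{[s]}|⁻¹ ≤ G(C_𝒜, M, |s|) < ∞`,
where `G` will be given in an explicitly computable manner" — for every `|a| ≤ M` with the same
`G` ("uniform in the specific angular momentum", §5.1; Thm. 1.3). Rendered for `|a| < M`,
pointwise in the frequencies, with the `sup` over `a ∈ [−M, M]` in `C_𝒜` evaluated
(`|ω − am/(2M²)|⁻¹ δ_{|a|,M}` is `|ω ∓ m/(2M)|⁻¹` at `a = ±M` and `0` otherwise) and the printed
`G` squared: for `M > 0`, `2s ∈ ℤ`, there is `G : ℝ → ℝ` with, for all `C`, all `|a| < M`, all `m`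
with `m − s ∈ ℤ` (admissible w.r.t. `s`), real `ω` with `ω ≠ 0`, `ω ≠ ±m/(2M)` (explicit because
`0⁻¹ = 0` in Mathlib), real `λ` with
`|ω| + |ω|⁻¹ + max(|ω − m/(2M)|⁻¹, |ω + m/(2M)|⁻¹) + |m| + |λ| ≤ C`, and all classical solutions
`R_𝓗`, `R_𝓘` of the homogeneous radial Teukolsky ODE on `(r₊, ∞)` normalised at `𝓗⁺` resp. `𝓘⁺`
as in Def. 2.3: `0 < G(C)` and `1 ≤ G(C) · |𝔚(r)|²` for every `r > r₊` (i.e. `|𝔚|⁻² ≤ G(C)`, in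
particular `𝔚 ≠ 0`; `𝔚 = Δ^{1+s}(R_𝓗 R'_𝓘 − R_𝓘 R'_𝓗)` is constant in `r`, Remark 5.1). The
extremal case `|a| = M` and the explicit form of `G` are not rendered (module docstring).
[cite: Costa2019, Theorem 5.1] -/
def Costa2019_wronskianBound_subextremal : Prop :=
  ∀ (M s : ℝ), 0 < M → (∃ k : ℤ, 2 * s = k) → ∃ G : ℝ → ℝ, ∀ (C a ω m lam : ℝ), |a| < M →
    (∃ k : ℤ, m - s = k) → ω ≠ 0 → ω ≠ m / (2 * M) → ω ≠ -(m / (2 * M)) →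
      |ω| + |ω|⁻¹ + max |ω - m / (2 * M)|⁻¹ |ω + m / (2 * M)|⁻¹ + |m| + |lam| ≤ C →
        ∀ RH RI : ℝ → ℂ,
          IsRadialTeukolskySolution M a s ω m lam RH → IsNormalisedHorizonSolution M a s ω m RH →
          IsRadialTeukolskySolution M a s ω m lam RI → IsNormalisedInfinitySolution M s ω RI →
            0 < G C ∧ ∀ r : ℝ, rPlus M a < r → 1 ≤ G C * ‖radialWronskian M a s RH RI r‖ ^ 2

/-! ### Sanity: the bound forces a non-vanishing Wronskian -/

/-- Theorem 5.1 implies mode stability in Wronskian form: under its hypotheses the Wronskian of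
the normalised horizon/infinity solutions does not vanish (Cor. 5.1 of the source for `|a| < M`,
away from `ω ∈ {0, ±m/(2M)}`). [cite: Costa2019, Corollary 5.1] -/
theorem Costa2019_wronskianBound_subextremal.wronskian_ne_zero
    (h : Costa2019_wronskianBound_subextremal) {M s : ℝ} (hM : 0 < M) (hs : ∃ k : ℤ, 2 * s = k) :
    ∀ (C a ω m lam : ℝ), |a| < M → (∃ k : ℤ, m - s = k) → ω ≠ 0 → ω ≠ m / (2 * M) →
      ω ≠ -(m / (2 * M)) →
      |ω| + |ω|⁻¹ + max |ω - m / (2 * M)|⁻¹ |ω + m / (2 * M)|⁻¹ + |m| + |lam| ≤ C →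
        ∀ RH RI : ℝ → ℂ,
          IsRadialTeukolskySolution M a s ω m lam RH → IsNormalisedHorizonSolution M a s ω m RH →
          IsRadialTeukolskySolution M a s ω m lam RI → IsNormalisedInfinitySolution M s ω RI →
            ∀ r : ℝ, rPlus M a < r → radialWronskian M a s RH RI r ≠ 0 := by
  obtain ⟨G, hG⟩ := h M s hM hs
  intro C a ω m lam ha hm hω hω₁ hω₂ hC RH RI h1 h2 h3 h4 r hr hzero
  obtain ⟨-, hbound⟩ := hG C a ω m lam ha hm hω hω₁ hω₂ hC RH RI h1 h2 h3 h4
  have := hbound r hr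
  rw [hzero, norm_zero, zero_pow two_ne_zero, mul_zero] at this
  exact absurd this (by norm_num)

end Literature.Geometry.Lorentzian.Kerr

end
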